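import Summits.ResolutionOfSingularities.ResolutionOfSingularities.Theorems.FrobeniusLadderFRationalResolutionPointCentreBlowupRegular
import Summits.ResolutionOfSingularities.ResolutionOfSingularities.Theorems.FrobeniusLadderFRationalResolutionSingularPointsOverVertex
import Summits.ResolutionOfSingularities.ResolutionOfSingularities.Theorems.FrobeniusLadderFRationalResolutionDivisorialIdealsCharacteristic
import HarnessLib

/-!
# Crux `FrobeniusLadder.FRationalResolution` (stmt-ResolutionOfSingularities-15317), line `redirect`,
# stub `stub_diagonalizableQuotientResolution` — THE INTRINSIC TWO-STEP RECIPE FOR A TWISTED ISOLATED POINT, ASSEMBLED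
# (capstone of leafhand2-g17: p838347 ∘ p839317 ∘ p839565 ∘ p839146; MEMO-15317-leafhand2-g17 §2)

One theorem to cite for the (S1) recipe of MEMO-15317-leafhand2-g16 §2(c) («blow up the characteristic class-group centre of `Ê`, then the
finitely many singular (conifold) points»), with every plumbing hypothesis of this generation's files discharged and only the GENUINE inputs left:

★★★ `hloc_of_characteristic_then_singularPoints` — Galois-route data of p838347 (`ι : Spec B ↪ X` over `K`, isolated singular `𝔭`, `K'/K` finite Galois,
`𝔔'` maximal over `𝔭`, `Ê = ((B ⊗_K K')_{𝔔'})^`) and: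
  (1) a proper ideal `J₁ ⊇ (𝔔'Ê)ⁿ` of `Ê` mapped into itself by every ring automorphism of `Ê` (CHARACTERISTIC);
  (2) the singular locus of `X₁ = Bl_{J₁}(Spec Ê)` is closed and consists of closed points;
  (3) at each singular `z ∈ X₁`, `Bl_{𝔪_z}(Spec 𝒪_{X₁,z})` is regular (e.g. `𝒪̂_{X₁,z} ≅` completed Segre vertex, `…PointBlowupOfCompletion`)
  ⟹ `hloc` at the twisted point `ι 𝔭` (the local resolution datum consumed by `IsolatedGlue` / p838474).
The hypothesis «singular points lie over `V(𝔪̂)`» of `…PointCentreBlowupRegular` is discharged by `…SingularPointsOverVertex.hZ𝔪_of_galois`.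

★★★ `hloc_of_traceIdealCentre_then_singularPoints` — the same with (1) replaced by its intended instance: `J₁ = 𝔞_totᴺ`, `𝔞_tot = ∏_{T ∈ 𝒯} T`,
`𝒯` = the (assumed FINITE) set of trace ideals of the nonzero divisorial ideals of `Ê` (`…DivisorialIdealsCharacteristic`, p839146: characteristic for free),
with `(𝔔'Ê)ⁿ ⊆ 𝔞_totᴺ ≠ ⊤`.

What remains GENUINE (MEMO-15317-leafhand2-g17 §3): finiteness of `𝒯` and its identification (class group of the complete toric germ, (α′) [L]); the fan
facts behind (2)–(3) for `Bl_{𝔞_totᴺ}` ((β): prints Nakamura/Craw–Reid/Kędzierski or per-class certificates [L]). Honest label: assembly toward ONE leaf stub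
(no stub, crux or summit closed). No definitions, no named facts, no sorry.
[cite: StacksProject, Tag 080B; Tag 0CDQ; Tag 09EB] [cite: Matsumura1987, Thm. 8.11; Thm. 8.14; Thm. 23.7] [cite: GortzWedhorn2020, Prop. 13.91]
-/

noncomputable section

-- single-problem summit: the doubled namespace component is forced
set_option linter.dupNamespace false

open CategoryTheory CategoryTheory.Limits AlgebraicGeometry TopologicalSpace TensorProduct IsLocalRing
open Literature.AlgebraicGeometry.Resolution
open Summit.ResolutionOfSingularities.ResolutionOfSingularities.Theorems.FRationalResolution

namespace Summit.ResolutionOfSingularities.ResolutionOfSingularities.Theorems.FRationalResolution.IntrinsicRecipe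

/-- ★★★ **A CHARACTERISTIC CENTRE, THEN THE SINGULAR POINTS, SETTLES THE TWISTED POINT.** See the module docstring.
[cite: StacksProject, Tag 080B; Tag 0CDQ; Tag 09EB] [cite: Matsumura1987, Thm. 8.11; Thm. 8.14; Thm. 23.7] -/
theorem hloc_of_characteristic_then_singularPoints (K : Type) [Field K] (X : Scheme.{0}) [IsIntegral X]
    (f : X ⟶ Spec (.of K)) [LocallyOfFiniteType f]
    {B : Type} [CommRing B] [IsDomain B] [Algebra K B] [Algebra.FiniteType K B]
    (ι : Spec (.of B) ⟶ X) [IsOpenImmersion ι] (hι : ι ≫ f = Spec.map (CommRingCat.ofHom (algebraMap K B)))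
    (𝔭 : Ideal B) [h𝔭 : 𝔭.IsMaximal] (h𝔭0 : 𝔭 ≠ ⊥)
    (hsing : ι ⟨𝔭, h𝔭.isPrime⟩ ∉ Scheme.regularLocus X)
    (hregB : ∀ P : Spec (.of B), P.asIdeal ≠ 𝔭 → P ∈ Scheme.regularLocus (Spec (.of B)))
    (K' : Type) [Field K'] [Algebra K K'] [FiniteDimensional K K'] [IsGalois K K']
    (𝔔' : Ideal (B ⊗[K] K')) [h𝔔' : 𝔔'.IsMaximal] (h𝔔'𝔭 : 𝔔'.comap (algebraMap B (B ⊗[K] K')) = 𝔭)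
    (J₁ : Ideal (AdicCompletion (maximalIdeal (Localization.AtPrime 𝔔')) (Localization.AtPrime 𝔔'))) {n : ℕ}
    (hn : 𝔔'.map (algebraMap (B ⊗[K] K')
      (AdicCompletion (maximalIdeal (Localization.AtPrime 𝔔')) (Localization.AtPrime 𝔔'))) ^ n ≤ J₁)
    (hJ₁top : J₁ ≠ ⊤)
    (hchar : ∀ θ : AdicCompletion (maximalIdeal (Localization.AtPrime 𝔔')) (Localization.AtPrime 𝔔') ≃+*
        AdicCompletion (maximalIdeal (Localization.AtPrime 𝔔')) (Localization.AtPrime 𝔔'), J₁.map (θ : _ →+* _) ≤ J₁)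
    (hZc : IsClosed (Scheme.regularLocus (affineBlowup J₁))ᶜ)
    (hpt : ∀ z ∈ (Scheme.regularLocus (affineBlowup J₁))ᶜ, IsClosed ({z} : Set (affineBlowup J₁)))
    (hloc : ∀ z ∈ (Scheme.regularLocus (affineBlowup J₁))ᶜ,
      Scheme.IsRegular (affineBlowup (maximalIdeal ((affineBlowup J₁).presheaf.stalk z)))) :
    ∃ (V : X.Opens), ι ⟨𝔭, h𝔭.isPrime⟩ ∈ V ∧
      (∀ t : X, t ∉ Scheme.regularLocus X → t ∈ V → t = ι ⟨𝔭, h𝔭.isPrime⟩) ∧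
      ∃ (Y : Scheme.{0}) (ρ : Y ⟶ V), IsProper ρ ∧ Scheme.IsRegular Y ∧
        IsIso (ρ ∣_ (V.ι ⁻¹ᵁ ⟨Scheme.regularLocus X, isOpen_regularLocus_of_locallyOfFiniteType_field f⟩)) ∧
        Dense ((ρ ⁻¹ᵁ (V.ι ⁻¹ᵁ ⟨Scheme.regularLocus X,
          isOpen_regularLocus_of_locallyOfFiniteType_field f⟩) : Y.Opens) : Set Y) := by
  haveI : IsNoetherianRing B := Algebra.FiniteType.isNoetherianRing K B
  haveI : Algebra.FiniteType B (B ⊗[K] K') := inferInstance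
  haveI : IsNoetherianRing (B ⊗[K] K') := Algebra.FiniteType.isNoetherianRing B (B ⊗[K] K')
  haveI : IsNoetherianRing (Localization.AtPrime 𝔔') :=
    IsLocalization.isNoetherianRing 𝔔'.primeCompl (Localization.AtPrime 𝔔') inferInstance
  set Ê := AdicCompletion (maximalIdeal (Localization.AtPrime 𝔔')) (Localization.AtPrime 𝔔') with hÊ
  haveI : IsNoetherianRing Ê := isNoetherianRing_adicCompletion_maximalIdeal _
  have hfac : algebraMap (B ⊗[K] K') Ê = (algebraMap (Localization.AtPrime 𝔔') Ê).comp (algebraMap (B ⊗[K] K') (Localization.AtPrime 𝔔')) :=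
    RingHom.ext fun _ => rfl
  have hmapQ : 𝔔'.map (algebraMap (B ⊗[K] K') Ê) = maximalIdeal Ê := by
    rw [hfac, ← Ideal.map_map, Localization.AtPrime.map_eq_maximalIdeal, ← AdicCompletion.maximalIdeal_eq_map]
  set 𝔪 := 𝔔'.map (algebraMap (B ⊗[K] K') Ê) with h𝔪
  -- `J₁ ⊆ 𝔪̂` (a proper ideal of a local ring)
  have hJ₁𝔪 : J₁ ≤ 𝔪 := by
    rw [hmapQ]
    exact IsLocalRing.le_maximalIdeal hJ₁top
  -- singular points of `Bl_{J₁}` lie over `V(𝔪̂)` (hygiene, discharged)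
  have hZ𝔪 : ∀ z ∈ (Scheme.regularLocus (affineBlowup J₁))ᶜ, 𝔪 ≤ (affineBlowup.π J₁ z).asIdeal :=
    SingularPointsOverVertex.hZ𝔪_of_galois K 𝔭 hregB K' 𝔔' J₁ hn hJ₁𝔪
  -- the packaged two-step tower
  obtain ⟨J₂, c, hchar₂, hc, hJ₂top, hreg₂⟩ :=
    PointCentreBlowupRegular.exists_characteristic_ideal_isRegular_of_singularPoints 𝔪 J₁ hn hJ₁top hchar hZc hpt hZ𝔪 hloc
  exact GaloisCharacteristicCentre.hloc_of_characteristic_ideal_adicCompletion K X f ι hι 𝔭 h𝔭0 hsing hregB K' 𝔔' h𝔔'𝔭 J₂ hc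
    hJ₂top (fun θ => hchar₂ θ) hreg₂

/-- ★★★ **THE CLASS-GROUP CENTRE, THEN THE SINGULAR POINTS.** As `hloc_of_characteristic_then_singularPoints` with `J₁ = 𝔞_totᴺ`, `𝔞_tot = ∏_{T ∈ 𝒯} T`, `𝒯` the
finite set of trace ideals `τ(I) = Σ_φ φ(I)` of the nonzero divisorial ideals `I` of `Ê` (characteristic by `…DivisorialIdealsCharacteristic`, p839146).
[cite: StacksProject, Tag 080B; Tag 0CDQ; Tag 09EB] [cite: Matsumura1987, Thm. 8.11; Thm. 8.14; §11] -/
theorem hloc_of_traceIdealCentre_then_singularPoints (K : Type) [Field K] (X : Scheme.{0}) [IsIntegral X]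
    (f : X ⟶ Spec (.of K)) [LocallyOfFiniteType f]
    {B : Type} [CommRing B] [IsDomain B] [Algebra K B] [Algebra.FiniteType K B]
    (ι : Spec (.of B) ⟶ X) [IsOpenImmersion ι] (hι : ι ≫ f = Spec.map (CommRingCat.ofHom (algebraMap K B)))
    (𝔭 : Ideal B) [h𝔭 : 𝔭.IsMaximal] (h𝔭0 : 𝔭 ≠ ⊥)
    (hsing : ι ⟨𝔭, h𝔭.isPrime⟩ ∉ Scheme.regularLocus X)
    (hregB : ∀ P : Spec (.of B), P.asIdeal ≠ 𝔭 → P ∈ Scheme.regularLocus (Spec (.of B)))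
    (K' : Type) [Field K'] [Algebra K K'] [FiniteDimensional K K'] [IsGalois K K']
    (𝔔' : Ideal (B ⊗[K] K')) [h𝔔' : 𝔔'.IsMaximal] (h𝔔'𝔭 : 𝔔'.comap (algebraMap B (B ⊗[K] K')) = 𝔭)
    (hfin : Set.Finite {T : Ideal (AdicCompletion (maximalIdeal (Localization.AtPrime 𝔔')) (Localization.AtPrime 𝔔')) |
      ∃ I : Ideal (AdicCompletion (maximalIdeal (Localization.AtPrime 𝔔')) (Localization.AtPrime 𝔔')),
        (I ≠ ⊥ ∧ ∀ x, (∀ a b, (∀ y ∈ I, b * y ∈ Ideal.span {a}) → b * x ∈ Ideal.span {a}) → x ∈ I) ∧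
        T = ⨆ φ : I →ₗ[AdicCompletion (maximalIdeal (Localization.AtPrime 𝔔')) (Localization.AtPrime 𝔔')]
          AdicCompletion (maximalIdeal (Localization.AtPrime 𝔔')) (Localization.AtPrime 𝔔'), LinearMap.range φ})
    (N : ℕ) {n : ℕ}
    (hn : 𝔔'.map (algebraMap (B ⊗[K] K')
      (AdicCompletion (maximalIdeal (Localization.AtPrime 𝔔')) (Localization.AtPrime 𝔔'))) ^ n ≤ (∏ T ∈ hfin.toFinset, T) ^ N)
    (htop : (∏ T ∈ hfin.toFinset, T) ^ N ≠ ⊤)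
    (hZc : IsClosed (Scheme.regularLocus (affineBlowup ((∏ T ∈ hfin.toFinset, T) ^ N)))ᶜ)
    (hpt : ∀ z ∈ (Scheme.regularLocus (affineBlowup ((∏ T ∈ hfin.toFinset, T) ^ N)))ᶜ,
      IsClosed ({z} : Set (affineBlowup ((∏ T ∈ hfin.toFinset, T) ^ N))))
    (hloc : ∀ z ∈ (Scheme.regularLocus (affineBlowup ((∏ T ∈ hfin.toFinset, T) ^ N)))ᶜ,
      Scheme.IsRegular (affineBlowup (maximalIdeal ((affineBlowup ((∏ T ∈ hfin.toFinset, T) ^ N)).presheaf.stalk z)))) :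
    ∃ (V : X.Opens), ι ⟨𝔭, h𝔭.isPrime⟩ ∈ V ∧
      (∀ t : X, t ∉ Scheme.regularLocus X → t ∈ V → t = ι ⟨𝔭, h𝔭.isPrime⟩) ∧
      ∃ (Y : Scheme.{0}) (ρ : Y ⟶ V), IsProper ρ ∧ Scheme.IsRegular Y ∧
        IsIso (ρ ∣_ (V.ι ⁻¹ᵁ ⟨Scheme.regularLocus X, isOpen_regularLocus_of_locallyOfFiniteType_field f⟩)) ∧
        Dense ((ρ ⁻¹ᵁ (V.ι ⁻¹ᵁ ⟨Scheme.regularLocus X,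
          isOpen_regularLocus_of_locallyOfFiniteType_field f⟩) : Y.Opens) : Set Y) :=
  hloc_of_characteristic_then_singularPoints K X f ι hι 𝔭 h𝔭0 hsing hregB K' 𝔔' h𝔔'𝔭 _ hn htop
    (DivisorialIdealsCharacteristic.forall_map_pow_prod_traceIdeal_divisorial_le hfin N) hZc hpt hloc

end Summit.ResolutionOfSingularities.ResolutionOfSingularities.Theorems.FRationalResolution.IntrinsicRecipe

end
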